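import Summits.AtomisticToContinuum.HydrodynamicLimit.Theorems.StiffCollisionalRelaxationAprioriBoundsPartOneChain
import HarnessLib

/-!
# Truncation and Markov–Tonelli tools for component (i) of the a-priori crux (line `Sketch`, reshape r7)

Supporting file of the line `Sketch` for the crux `AprioriBounds` (stmt-AtomisticToContinuum-14827;
`StiffCollisionalRelaxation.AprioriBounds` = `CollisionIsometryCLT.AprioriBoundsPreShock`), lead prover
`prover-line-stmt-AtomisticToContinuum-14827-c4-0`.  These are the model-independent steps of the glue
`stub_partOneOfTails` (file `…AprioriBoundsPartOneOfTails.lean`), which derives component (i) — a FIXED bound, with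
probability `→ 1`, on the time-averaged empirical exponential velocity moment — from an expected Gaussian moment
along the flow plus fixed-time convergence in probability of truncated averages:

* `tendsto_lintegral_abs_sub_const`: bounded random variables converging in probability to a constant converge in
  `L¹`; `lintegral_abs_sub_integral_le`: centring at the mean costs a factor `2`;
* `sub_min_le_sq_div`: the truncation inequality `a − a ∧ K ≤ a²/K`;
* `aemeasurable_real_comp_flow_prod`: real observables along a hard-sphere flow are a.e.-jointly measurable in
  `(z, s)` under laws carried by the good set (twin of `aemeasurable_comp_flow_prod₂`);
* `tendsto_setLIntegral_Icc_of_dominated`: dominated convergence on the time window;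
* `measure_timeAvg_gt_le_of_trunc`: the Markov–Tonelli step — for observables `0 ≤ W ≤ G`, `W ≤ K`,
  `G − W ≤ M/K`, `E M(Φ_s ·) ≤ C` on `[0,t]` and an a.e.-measurable centring `0 ≤ g ≤ K ∧ C`,
  `P{tC + 1 < ∫₀ᵗ G(Φ_s z) ds} ≤ ∫₀ᵗ E|W(Φ_s ·) − g(s)| ds + (C/K)·t` (same route as the landed `stub_partOneChain`:
  pathwise decomposition on good orbits, Markov, Tonelli on `good × [0,t]`).

No new definitions, no named facts; axioms `propext`, `Classical.choice`, `Quot.sound`.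
-/

noncomputable section

open MeasureTheory Filter Set Topology
open scoped ENNReal

namespace Summit.AtomisticToContinuum.HydrodynamicLimit.Theorems.AdiabatCeiling

open Literature.MathematicalPhysics.KineticTheory Literature.Analysis.FluidPDE

/-! ## Abstract probability lemmas -/

/-- A real random variable with values in `[0, K]` on a finite measure space is integrable. -/
theorem integrable_of_mem_Icc {Ω : Type*} [MeasurableSpace Ω] {P : Measure Ω} [IsFiniteMeasure P]
    {X : Ω → ℝ} (hX : Measurable X) {K : ℝ} (h0 : ∀ ω, 0 ≤ X ω) (hXK : ∀ ω, X ω ≤ K) :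
    Integrable X P := by
  have h := Measure.integrableOn_of_bounded (μ := P) (s := univ) (f := X) (M := K) (measure_ne_top P univ)
    hX.aestronglyMeasurable (ae_of_all _ fun ω => by
      rw [Real.norm_eq_abs, abs_of_nonneg (h0 ω)]; exact hXK ω)
  rwa [integrableOn_univ] at h

/-- **Bounded random variables converging in probability to a constant converge in `L¹`.**  On probability
spaces `(Ω_N, P_N)`, measurable `X_N` with values in `[0, K]` and `P_N{δ < |X_N − m|} → 0` for every `δ > 0`
satisfy `E|X_N − m| → 0`. -/
theorem tendsto_lintegral_abs_sub_const {Ω : ℕ → Type*} [∀ N, MeasurableSpace (Ω N)]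
    (P : ∀ N, Measure (Ω N)) [∀ N, IsProbabilityMeasure (P N)] (X : ∀ N, Ω N → ℝ)
    (hX : ∀ N, Measurable (X N)) {K : ℝ} (h0 : ∀ N ω, 0 ≤ X N ω) (hXK : ∀ N ω, X N ω ≤ K) (m : ℝ)
    (hm : ∀ δ : ℝ, 0 < δ → Tendsto (fun N => P N {ω | δ < |X N ω - m|}) atTop (𝓝 0)) :
    Tendsto (fun N => ∫⁻ ω, ENNReal.ofReal |X N ω - m| ∂P N) atTop (𝓝 0) := by
  refine ENNReal.tendsto_nhds_zero.2 fun ε hε => ?_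
  rcases eq_top_or_lt_top ε with rfl | hεtop
  · exact Eventually.of_forall fun N => le_top
  have hε0 : 0 < ε.toReal := ENNReal.toReal_pos hε.ne' hεtop.ne
  set δ : ℝ := ε.toReal / 2 with hδ
  have hδ0 : 0 < δ := by positivity
  have hmeas : ∀ N, MeasurableSet {ω | δ < |X N ω - m|} := fun N =>
    measurableSet_lt measurable_const ((hX N).sub measurable_const).abs
  have hpt : ∀ N ω, ENNReal.ofReal |X N ω - m| ≤
      ENNReal.ofReal δ + ENNReal.ofReal (K + |m|) * {ω | δ < |X N ω - m|}.indicator 1 ω := by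
    intro N ω
    by_cases hω : δ < |X N ω - m|
    · have hle : |X N ω - m| ≤ K + |m| := by
        calc |X N ω - m| ≤ |X N ω| + |m| := abs_sub _ _
          _ ≤ K + |m| := by rw [abs_of_nonneg (h0 N ω)]; exact add_le_add (hXK N ω) le_rfl
      have hmem : ω ∈ {ω | δ < |X N ω - m|} := hω
      rw [indicator_of_mem hmem, Pi.one_apply, mul_one]
      exact (ENNReal.ofReal_le_ofReal hle).trans le_add_self
    · have hmem : ω ∉ {ω | δ < |X N ω - m|} := hω
      rw [indicator_of_notMem hmem, mul_zero, add_zero]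
      exact ENNReal.ofReal_le_ofReal (not_lt.1 hω)
  have hbound : ∀ N, ∫⁻ ω, ENNReal.ofReal |X N ω - m| ∂P N ≤
      ENNReal.ofReal δ + ENNReal.ofReal (K + |m|) * P N {ω | δ < |X N ω - m|} := by
    intro N
    calc ∫⁻ ω, ENNReal.ofReal |X N ω - m| ∂P N
        ≤ ∫⁻ ω, ENNReal.ofReal δ + ENNReal.ofReal (K + |m|) * {ω | δ < |X N ω - m|}.indicator 1 ω ∂P N :=
          lintegral_mono fun ω => hpt N ω
      _ = ENNReal.ofReal δ + ENNReal.ofReal (K + |m|) * P N {ω | δ < |X N ω - m|} := by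
          rw [lintegral_add_left measurable_const, lintegral_const, measure_univ, mul_one,
            lintegral_const_mul _ (measurable_one.indicator (hmeas N)), lintegral_indicator_one (hmeas N)]
  have h2 : Tendsto (fun N => ENNReal.ofReal (K + |m|) * P N {ω | δ < |X N ω - m|}) atTop (𝓝 0) := by
    have h := ENNReal.Tendsto.const_mul (a := ENNReal.ofReal (K + |m|)) (hm δ hδ0)
      (Or.inr ENNReal.ofReal_ne_top)
    rwa [mul_zero] at h
  have hhalf : ENNReal.ofReal δ = ε / 2 := by
    rw [hδ, ENNReal.ofReal_div_of_pos two_pos, ENNReal.ofReal_toReal hεtop.ne, ENNReal.ofReal_ofNat]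
  filter_upwards [ENNReal.tendsto_nhds_zero.1 h2 (ε / 2) (ENNReal.half_pos hε.ne')] with N hN
  calc ∫⁻ ω, ENNReal.ofReal |X N ω - m| ∂P N
      ≤ ENNReal.ofReal δ + ENNReal.ofReal (K + |m|) * P N {ω | δ < |X N ω - m|} := hbound N
    _ ≤ ε / 2 + ε / 2 := by rw [hhalf]; exact add_le_add le_rfl hN
    _ = ε := ENNReal.add_halves ε

/-- **Centring at the mean costs a factor two**: for an integrable real `X` on a probability space and any
constant `m`, `E|X − E X| ≤ 2 E|X − m|`. -/
theorem lintegral_abs_sub_integral_le {Ω : Type*} [MeasurableSpace Ω] {P : Measure Ω} [IsProbabilityMeasure P]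
    {X : Ω → ℝ} (hX : Integrable X P) (m : ℝ) :
    ∫⁻ ω, ENNReal.ofReal |X ω - ∫ ω', X ω' ∂P| ∂P ≤ 2 * ∫⁻ ω, ENNReal.ofReal |X ω - m| ∂P := by
  have hintm : Integrable (fun ω => X ω - m) P := hX.sub (integrable_const m)
  have h1 : |(∫ ω', X ω' ∂P) - m| ≤ ∫ ω', |X ω' - m| ∂P := by
    have h : (∫ ω', X ω' ∂P) - m = ∫ ω', (X ω' - m) ∂P := by
      rw [integral_sub hX (integrable_const m), integral_const, probReal_univ, one_smul]
    rw [h]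
    exact abs_integral_le_integral_abs
  have h2 : ENNReal.ofReal (∫ ω', |X ω' - m| ∂P) = ∫⁻ ω', ENNReal.ofReal |X ω' - m| ∂P :=
    ofReal_integral_eq_lintegral_ofReal hintm.abs (ae_of_all _ fun _ => abs_nonneg _)
  calc ∫⁻ ω, ENNReal.ofReal |X ω - ∫ ω', X ω' ∂P| ∂P
      ≤ ∫⁻ ω, ENNReal.ofReal |X ω - m| + ENNReal.ofReal |(∫ ω', X ω' ∂P) - m| ∂P := by
        refine lintegral_mono fun ω => ?_
        rw [← ENNReal.ofReal_add (abs_nonneg _) (abs_nonneg _)]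
        refine ENNReal.ofReal_le_ofReal ?_
        calc |X ω - ∫ ω', X ω' ∂P| = |(X ω - m) - ((∫ ω', X ω' ∂P) - m)| := by ring_nf
          _ ≤ |X ω - m| + |(∫ ω', X ω' ∂P) - m| := abs_sub _ _
    _ = (∫⁻ ω, ENNReal.ofReal |X ω - m| ∂P) + ENNReal.ofReal |(∫ ω', X ω' ∂P) - m| := by
        rw [lintegral_add_right _ measurable_const, lintegral_const, measure_univ, mul_one]
    _ ≤ (∫⁻ ω, ENNReal.ofReal |X ω - m| ∂P) + ∫⁻ ω, ENNReal.ofReal |X ω - m| ∂P := by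
        refine add_le_add le_rfl ?_
        rw [← h2]
        exact ENNReal.ofReal_le_ofReal h1
    _ = 2 * ∫⁻ ω, ENNReal.ofReal |X ω - m| ∂P := by rw [two_mul]

/-! ## Truncation arithmetic -/

/-- For real `a` and `K > 0`: `a − a ∧ K ≤ a²/K` (if `a ≤ K` the left side is `0`; otherwise
`(a − K)K ≤ a²`). -/
theorem sub_min_le_sq_div {a K : ℝ} (hK : 0 < K) : a - min a K ≤ a ^ 2 / K := by
  rcases le_total a K with h | h
  · rw [min_eq_left h, sub_self]
    positivity
  · rw [min_eq_right h, le_div_iff₀ hK]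
    nlinarith [sq_nonneg (a - K), sq_nonneg K]


/-- Real observables composed with a hard-sphere flow are a.e.-jointly measurable in `(z, s)` for every law
carried by the good set (real-valued twin of `aemeasurable_comp_flow_prod₂`, through `x = x⁺ − x⁻`). -/
theorem aemeasurable_real_comp_flow_prod {n : ℕ} {ε : ℝ} (Φ : HardSphereFlow (Torus.geometry (Fin 3)) ε n)
    {W : Config n (Fin 3) T3 → ℝ} (hWm : Measurable W) {P : Measure (Config n (Fin 3) T3)}
    (hP : P Φ.goodᶜ = 0) (ν : Measure ℝ) [SFinite ν] :
    AEMeasurable (fun p : Config n (Fin 3) T3 × ℝ => W (Φ.flow p.2 p.1)) (P.prod ν) := by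
  have h1 := (aemeasurable_comp_flow_prod₂ Φ (hWm.ennreal_ofReal.comp measurable_fst) hP ν).ennreal_toReal
  have h2 := (aemeasurable_comp_flow_prod₂ Φ (hWm.neg.ennreal_ofReal.comp measurable_fst) hP ν).ennreal_toReal
  refine (h1.sub h2).congr (ae_of_all _ fun p => ?_)
  simp only [Function.comp_apply, ENNReal.toReal_ofReal']
  exact max_zero_sub_max_neg_zero_eq_self _

/-- Dominated convergence on the time window, in the form used below: `ν`-a.e.-measurable `H_N ≤ K` on `[0,t]`
tending to `0` for a.e. `s` have `∫₀ᵗ H_N → 0`. -/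
theorem tendsto_setLIntegral_Icc_of_dominated {t K : ℝ} (H : ℕ → ℝ → ℝ≥0∞)
    (hHm : ∀ N, AEMeasurable (H N) (volume.restrict (Icc 0 t)))
    (hHK : ∀ N, ∀ᵐ s ∂(volume.restrict (Icc 0 t)), H N s ≤ ENNReal.ofReal K)
    (hlim : ∀ᵐ s ∂(volume.restrict (Icc 0 t)), Tendsto (fun N => H N s) atTop (𝓝 0)) :
    Tendsto (fun N => ∫⁻ s in Icc 0 t, H N s) atTop (𝓝 0) := by
  have hfin : ∫⁻ _ in Icc 0 t, ENNReal.ofReal K ≠ ∞ := by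
    rw [lintegral_const, Measure.restrict_apply_univ, Real.volume_Icc]
    exact ENNReal.mul_ne_top ENNReal.ofReal_ne_top ENNReal.ofReal_ne_top
  have h := tendsto_lintegral_of_dominated_convergence' (fun _ => ENNReal.ofReal K) hHm hHK hfin hlim
  rwa [lintegral_zero] at h

/-- **Markov–Tonelli step of `stub_partOneOfTails` (one particle number).**  For a hard-sphere flow `Φ`, a
probability law `P` carried by its good set, real observables `W ≤ G` on phase space with `0 ≤ W ≤ K`,
an extended observable `M` dominating the remainder, `G − W ≤ M/K` (as `ofReal (G − W) ≤ M / ofReal K`), `G`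
bounded along every good orbit, `E_P M(Φ_s ·) ≤ C < ∞` on `[0,t]`, and an a.e.-measurable centring `g` on `[0,t]`
with `0 ≤ g ≤ K` and `g ≤ C` there:
`P{tC + 1 < ∫₀ᵗ G(Φ_s z) ds} ≤ ∫₀ᵗ E_P|W(Φ_s ·) − g(s)| ds + (C/K)·t`. -/
theorem measure_timeAvg_gt_le_of_trunc :
    ∀ {n : ℕ} {ε : ℝ} (Φ : HardSphereFlow (Torus.geometry (Fin 3)) ε n) (P : Measure (Config n (Fin 3) T3)),
      IsProbabilityMeasure P → P Φ.goodᶜ = 0 →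
      ∀ {G W : Config n (Fin 3) T3 → ℝ} {M : Config n (Fin 3) T3 → ℝ≥0∞},
      Measurable G → Measurable W → Measurable M →
      ∀ {t K : ℝ}, 0 < t → ∀ {C : ℝ≥0∞},
      (∀ w, 0 ≤ W w) → (∀ w, W w ≤ K) → (∀ w, W w ≤ G w) →
      (∀ w, ENNReal.ofReal (G w - W w) ≤ M w / ENNReal.ofReal K) →
      (∀ z ∈ Φ.good, ∃ B : ℝ, ∀ s, G (Φ.flow s z) ≤ B) →
      (∀ s ∈ Icc 0 t, ∫⁻ z, M (Φ.flow s z) ∂P ≤ C) →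
      ∀ {g : ℝ → ℝ}, AEMeasurable g (volume.restrict (Icc 0 t)) →
      (∀ s, 0 ≤ g s) → (∀ s, g s ≤ K) → (∀ s ∈ Icc 0 t, g s ≤ C.toReal) →
      P {z | t * C.toReal + 1 < ∫ s in Icc 0 t, G (Φ.flow s z)} ≤
        (∫⁻ s in Icc 0 t, ∫⁻ z, ENNReal.ofReal |W (Φ.flow s z) - g s| ∂P) +
          C / ENNReal.ofReal K * ENNReal.ofReal t := by
  intro n ε Φ P hprobP hP G W M hGm hWm hMm t K ht C hW0 hWK hWG hrem hGbdd hmom g hgm hg0 hgK hgC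
  haveI := hprobP
  set ν : Measure ℝ := volume.restrict (Icc 0 t) with hν
  have hνuniv : ν univ = ENNReal.ofReal t := by
    rw [hν, Measure.restrict_apply_univ, Real.volume_Icc, sub_zero]
  haveI : IsFiniteMeasure ν := ⟨by rw [hνuniv]; exact ENNReal.ofReal_lt_top⟩
  -- the combined integrand and its orbit integral
  set F : Config n (Fin 3) T3 × ℝ → ℝ≥0∞ :=
    fun p => ENNReal.ofReal |W (Φ.flow p.2 p.1) - g p.2| + M (Φ.flow p.2 p.1) / ENNReal.ofReal K with hF
  set Y : Config n (Fin 3) T3 → ℝ≥0∞ := fun z => ∫⁻ s, F (z, s) ∂ν with hY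
  -- (1) on the good set the bad event forces `1 ≤ Y`
  have hincl : {z | t * C.toReal + 1 < ∫ s in Icc 0 t, G (Φ.flow s z)} ∩ Φ.good ⊆ {z | 1 ≤ Y z} := by
    rintro z ⟨hz1, hz⟩
    simp only [mem_setOf_eq] at hz1 ⊢
    have horb : Measurable fun s => Φ.flow s z := (Φ.isTrajectory z hz).measurable_torus
    obtain ⟨B, hB⟩ := hGbdd z hz
    have hGi : Integrable (fun s => G (Φ.flow s z)) ν := by
      refine Measure.integrableOn_of_bounded (M := B) measure_Icc_lt_top.ne
        (hGm.comp horb).aestronglyMeasurable (ae_of_all _ fun s => ?_)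
      rw [Real.norm_eq_abs, abs_of_nonneg ((hW0 _).trans (hWG _))]
      exact hB s
    have hWi : Integrable (fun s => W (Φ.flow s z)) ν := by
      refine Measure.integrableOn_of_bounded (M := K) measure_Icc_lt_top.ne
        (hWm.comp horb).aestronglyMeasurable (ae_of_all _ fun s => ?_)
      rw [Real.norm_eq_abs, abs_of_nonneg (hW0 _)]
      exact hWK _
    have hgi : Integrable g ν := by
      refine ⟨hgm.aestronglyMeasurable, HasFiniteIntegral.of_bounded (C := K) (ae_of_all _ fun s => ?_)⟩
      rw [Real.norm_eq_abs, abs_of_nonneg (hg0 s)]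
      exact hgK s
    have hdecomp : ∫ s, G (Φ.flow s z) ∂ν = (∫ s, (W (Φ.flow s z) - g s) ∂ν) + (∫ s, g s ∂ν) +
        ∫ s, (G (Φ.flow s z) - W (Φ.flow s z)) ∂ν := by
      rw [integral_sub hWi hgi, integral_sub hGi hWi]
      ring
    have hle1 : ∫ s, (W (Φ.flow s z) - g s) ∂ν ≤ ∫ s, |W (Φ.flow s z) - g s| ∂ν :=
      integral_mono (hWi.sub hgi) (hWi.sub hgi).abs fun s => le_abs_self _
    have hle2 : ∫ s, g s ∂ν ≤ t * C.toReal := by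
      have h : ∫ s, g s ∂ν ≤ ∫ _s, C.toReal ∂ν := by
        refine integral_mono_ae hgi (integrable_const _) ?_
        rw [hν, EventuallyLE, ae_restrict_iff' measurableSet_Icc]
        exact ae_of_all _ fun s hs => hgC s hs
      rw [integral_const, Measure.real, hνuniv, ENNReal.toReal_ofReal ht.le, smul_eq_mul] at h
      exact h
    have h1 : 1 < (∫ s, |W (Φ.flow s z) - g s| ∂ν) + ∫ s, (G (Φ.flow s z) - W (Φ.flow s z)) ∂ν := by
      rw [← hν] at hz1
      linarith
    have hA : ENNReal.ofReal (∫ s, |W (Φ.flow s z) - g s| ∂ν) =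
        ∫⁻ s, ENNReal.ofReal |W (Φ.flow s z) - g s| ∂ν :=
      ofReal_integral_eq_lintegral_ofReal (hWi.sub hgi).abs (ae_of_all _ fun _ => abs_nonneg _)
    have hB' : ENNReal.ofReal (∫ s, (G (Φ.flow s z) - W (Φ.flow s z)) ∂ν) =
        ∫⁻ s, ENNReal.ofReal (G (Φ.flow s z) - W (Φ.flow s z)) ∂ν :=
      ofReal_integral_eq_lintegral_ofReal (hGi.sub hWi) (ae_of_all _ fun s => sub_nonneg.2 (hWG _))
    have hnn1 : 0 ≤ ∫ s, |W (Φ.flow s z) - g s| ∂ν := integral_nonneg fun _ => abs_nonneg _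
    have hnn2 : 0 ≤ ∫ s, (G (Φ.flow s z) - W (Φ.flow s z)) ∂ν :=
      integral_nonneg fun s => sub_nonneg.2 (hWG _)
    have hsm : AEMeasurable (fun s => ENNReal.ofReal |W (Φ.flow s z) - g s|) ν :=
      (((hWm.comp horb).aemeasurable.sub hgm).abs).ennreal_ofReal
    calc (1 : ℝ≥0∞) = ENNReal.ofReal 1 := ENNReal.ofReal_one.symm
      _ ≤ ENNReal.ofReal ((∫ s, |W (Φ.flow s z) - g s| ∂ν) +
            ∫ s, (G (Φ.flow s z) - W (Φ.flow s z)) ∂ν) := ENNReal.ofReal_le_ofReal h1.le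
      _ = (∫⁻ s, ENNReal.ofReal |W (Φ.flow s z) - g s| ∂ν) +
            ∫⁻ s, ENNReal.ofReal (G (Φ.flow s z) - W (Φ.flow s z)) ∂ν := by
          rw [ENNReal.ofReal_add hnn1 hnn2, hA, hB']
      _ = ∫⁻ s, ENNReal.ofReal |W (Φ.flow s z) - g s| +
            ENNReal.ofReal (G (Φ.flow s z) - W (Φ.flow s z)) ∂ν := (lintegral_add_left' hsm _).symm
      _ ≤ Y z := lintegral_mono fun s => add_le_add le_rfl (hrem _)
  -- (2) joint a.e.-measurability of `F` along the flow
  have hWprod : AEMeasurable (fun p : Config n (Fin 3) T3 × ℝ => W (Φ.flow p.2 p.1)) (P.prod ν) :=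
    aemeasurable_real_comp_flow_prod Φ hWm hP ν
  have hMprod : AEMeasurable (fun p : Config n (Fin 3) T3 × ℝ => M (Φ.flow p.2 p.1)) (P.prod ν) :=
    aemeasurable_comp_flow_prod₂ Φ (hMm.comp measurable_fst) hP ν
  have hprod : AEMeasurable F (P.prod ν) :=
    ((hWprod.sub hgm.comp_snd).abs.ennreal_ofReal).add (hMprod.div_const _)
  have hYm : AEMeasurable Y P := hprod.lintegral_prod_right'
  -- (3) Markov
  have hPE : P {z | t * C.toReal + 1 < ∫ s in Icc 0 t, G (Φ.flow s z)} ≤ ∫⁻ z, Y z ∂P := by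
    calc P {z | t * C.toReal + 1 < ∫ s in Icc 0 t, G (Φ.flow s z)}
        ≤ P (({z | t * C.toReal + 1 < ∫ s in Icc 0 t, G (Φ.flow s z)} ∩ Φ.good) ∪ Φ.goodᶜ) :=
          measure_mono fun z hz => by
            by_cases h : z ∈ Φ.good
            · exact Or.inl ⟨hz, h⟩
            · exact Or.inr h
      _ ≤ P ({z | t * C.toReal + 1 < ∫ s in Icc 0 t, G (Φ.flow s z)} ∩ Φ.good) + P Φ.goodᶜ :=
          measure_union_le _ _
      _ = P ({z | t * C.toReal + 1 < ∫ s in Icc 0 t, G (Φ.flow s z)} ∩ Φ.good) := by rw [hP, add_zero]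
      _ ≤ P {z | 1 ≤ Y z} := measure_mono hincl
      _ = 1 * P {z | 1 ≤ Y z} := (one_mul _).symm
      _ ≤ ∫⁻ z, Y z ∂P := mul_meas_ge_le_lintegral₀ hYm 1
  -- (4) Tonelli and the two bounds per time slice
  have hslice : ∀ s ∈ Icc 0 t, ∫⁻ z, F (z, s) ∂P ≤
      (∫⁻ z, ENNReal.ofReal |W (Φ.flow s z) - g s| ∂P) + C / ENNReal.ofReal K := by
    intro s hs
    have hm1 : Measurable fun z => ENNReal.ofReal |W (Φ.flow s z) - g s| :=
      (((hWm.comp (Φ.measurable_flow s)).sub measurable_const).abs).ennreal_ofReal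
    have hm2 : Measurable fun z => M (Φ.flow s z) := hMm.comp (Φ.measurable_flow s)
    have hsplit : ∫⁻ z, F (z, s) ∂P = (∫⁻ z, ENNReal.ofReal |W (Φ.flow s z) - g s| ∂P) +
        (∫⁻ z, M (Φ.flow s z) ∂P) / ENNReal.ofReal K := by
      simp only [hF]
      rw [lintegral_add_left hm1, div_eq_mul_inv, ← lintegral_mul_const _ hm2]
      simp only [div_eq_mul_inv]
    rw [hsplit]
    exact add_le_add le_rfl (ENNReal.div_le_div_right (hmom s hs) _)
  have hTon : ∫⁻ z, Y z ∂P ≤ (∫⁻ s, ∫⁻ z, ENNReal.ofReal |W (Φ.flow s z) - g s| ∂P ∂ν) +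
      C / ENNReal.ofReal K * ENNReal.ofReal t := by
    have hsw : ∫⁻ z, Y z ∂P = ∫⁻ s, ∫⁻ z, F (z, s) ∂P ∂ν :=
      lintegral_lintegral_swap (f := fun z s => F (z, s)) hprod
    rw [hsw]
    have hae : ∀ᵐ s ∂ν, ∫⁻ z, F (z, s) ∂P ≤
        (∫⁻ z, ENNReal.ofReal |W (Φ.flow s z) - g s| ∂P) + C / ENNReal.ofReal K := by
      rw [hν, ae_restrict_iff' measurableSet_Icc]
      exact ae_of_all _ fun s hs => hslice s hs
    calc ∫⁻ s, ∫⁻ z, F (z, s) ∂P ∂ν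
        ≤ ∫⁻ s, (∫⁻ z, ENNReal.ofReal |W (Φ.flow s z) - g s| ∂P) + C / ENNReal.ofReal K ∂ν :=
          lintegral_mono_ae hae
      _ = (∫⁻ s, ∫⁻ z, ENNReal.ofReal |W (Φ.flow s z) - g s| ∂P ∂ν) + C / ENNReal.ofReal K * ν univ := by
          rw [lintegral_add_right' _ aemeasurable_const, lintegral_const]
      _ = _ := by rw [hνuniv]
  exact hPE.trans hTon


end Summit.AtomisticToContinuum.HydrodynamicLimit.Theorems.AdiabatCeiling
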